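/-
# `Balaban1983to89.B5SupCarrierTorus` — Bałaban CMP 95 (1984), Proposition 1.2, step S1 AS PRINTED on the torus of record:
# the sup-norm (`ℓ^∞`, (1.108)) and the adjoint (`ℓ¹`, p. 39) CARRIERS of the random walk (1.123) for `G = Δ_a⁻¹`, with the
# operators `G`, `Δ_a`, `h_z`, `∇`, the identities (1.118)/(1.71), and the field (1.115) READ ON BOTH CARRIERS

statement-level skeleton of published theorems with citation tags; proofs where landed; nothing here is a claim
about the Yang–Mills mass gap

CITATION HEADER (lean-in-tree rule).  Cell `lit-balaban`, unit `lit-balaban-p38` (Phase-2 proof seat p38 gen 8), HOME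
`run/shared/lean/pub/lit-balaban/` (SKELETON rows B5.Prop1.2, B5.Eq1.115-1.117, B5.Eq1.118, B5.Eq1.123, B5.Eq1.125, B5.Eq1.129;
owner r02).  B5 = T. Bałaban, *Propagators and renormalization transformations for lattice gauge theories. I*, Commun. Math.
Phys. **95** (1984) 17–40 [`Balaban1984PropagatorsI`], held as `paper:balaban1984-cmp95-propagators-rt-i` (journal page = PDF
page + 16).  FILE A of the p38-gen-8 half of the sup/Hölder (S1) torus instantiation of r02՚s `B5SupWalkS1.SupRealisation`
(B5-CLOSURE §5 item 2; the (1.128) leaves are r02 g11՚s `B5SupCommutator128` / `B5SupH128Torus`).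

WHAT IS PRINTED (verbatim; quoted from the renders certified in `B5Prop12FieldsLattice`, `B5.lean`, `B5SupWalk125`).
p. 35 (1.108): «The most fundamental are the supremum norm |A| = max_μ sup_x |A_μ(x)|, |∇A| = max_{μ,ν} sup_x |(∂_μA_ν)(x)|,
(1.108)».  p. 36 (1.115): «The localized inequalities (1.110)–(1.114) imply immediately the following global inequalities
|GJ|, |∇GJ|, |G∇*J|, |ΔGJ|, ‖∇GJ‖_α, ‖G∇*J‖_α ≤ O(1)|J|, (1.115)».  p. 36 (1.118): «hence Σ_z h_z²(x) = 1. (1.118)».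
p. 30 (1.71): «Δ_a⁻¹ = G_k, or simply G. (1.71)».  p. 38 [PDF 22 L5–6]: «The factors with G are estimated by using
(1.115).»  p. 39
[PDF 23 L7–9]: «The proofs of the other inequalities are exactly the same, but in the estimates of G∇*J we have to take a
representation of G adjoint to (1.123), with the operators K(h) acting on the right.»  p. 33, Prop. 1.1: «The operator G
is a symmetric operator on L²(T_η)».

WHAT THIS MODULE PROVES (kernel-checked, zero sorry) — for the REAL setting of record `B5SettingP12Real.latticeSettingP12R n M a k`
(fine torus `T_η = Tor (fine n M)`, `η = 1/n`, real vector fields `VecR n M = (T_η × {1..d}) → ℝ`):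
§1 THE SUP CARRIER: `VecR n M` with Mathlib՚s sup norm (= `|A|` of (1.108), `norm_eq_supNormL`) and the operators of the
   walk on it, built from r02՚s `ℓ^∞` vocabulary `B5SupCommutator128.kerOpS` / `mulOpS` so that the (1.128) schema
   `h128_schemaS` applies verbatim: `Gs = kerOpS GR` (`G`, pv15՚s real matrix `B5RealFields.GR = re (DeltaA)⁻¹`),
   `DAs = kerOpS DeltaAR` (`Δ_a`), `Hs z = mulOpS (hcoefS z)` (the multipliers `h_z` of p38-gen-7՚s `B5WalkPartitionTorus.hz`
   at the cube centres `B5WalkTorusGeom.Cen M M₀`), the gradient `Dgs = ∇` (`gradR`) into `Fin d → VecR n M` (sup norm =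
   `|∇A|` of (1.108)); the fields `h118` (`h118S`), `h71`/`h71'` (`DAs_mul_Gs`, `Gs_mul_DAs`), `normH` (`norm_Hs_le`) of
   `B5SupWalk125.SupModel` / `B5SupWalkS1.Rep`, and `DAs_eq_kerOpS_add` (any entrywise split `Δ_a = l + k` for the schema);
§2 THE ADJOINT CARRIER (p. 39): `V1 n M = PiLp 1 (T_η × {1..d} → ℝ)` (norm `Σ|A|`, `norm_V1`) with the SAME operators
   transported along `WithLp` (`G1`, `DA1`, `H1 z`, `Dg1`), their pointwise forms and the same three identities
   (`h118one`, `DA1_mul_G1`, `G1_mul_DA1`, `norm_H1_le`);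
§3 THE FIELD `h115` OF `B5SupWalkS1.Rep` ON BOTH CARRIERS from the typed global inequalities `B5.Global115_117
   (latticeSettingP12R n M a k) (gP12R M n a k) C Cα Cε Cαε` of the instance: on the sup carrier the members `|GJ| ≤ O(1)|J|`,
   `|∇GJ| ≤ O(1)|J|` of (1.115) read `‖Gs B‖ ≤ C‖B‖`, `‖Dgs (Gs B)‖ ≤ C‖B‖` (`norm_Gs_le_of_global`, `norm_Dgs_Gs_le_of_global`;
   also `|G∇*T| ≤ C|T|`: `norm_Gs_divTR_le_of_global`); on the adjoint carrier, BY DUALITY from `|GJ|`, `|G∇*J| ≤ O(1)|J|` and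
   the symmetry of `G` (the generic `ℓ¹`/`ℓ^∞` duality `sum_abs_mulVec_le_of_transpose`): `‖G1 w‖ ≤ C‖w‖`, `‖Dg1 (G1 w)‖ ≤ C‖w‖`
   (`norm_G1_le_of_global`, `norm_Dg1_G1_le_of_global`); packaged as `h115S_holds` / `h115one_holds` in the exact shape of the
   field `Rep.h115` (any `c_G ≥ 1`).

HONEST SCOPE / DIVERGENCE.  (1) Bookkeeping and elementary functional analysis only: no estimate of B5 is claimed here beyond
READING the typed (1.115) on the two carriers; (1.115)–(1.117) themselves are theorems of the tree for this family
(`B5Prop12GHolds.global115_117_famG_printed`, via the alternative Combes–Thomas route) and enter the S1 mechanism as its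
printed hypothesis.  (2) The adjoint representation of p. 39 is MODELLED (as announced in `B5SupWalkS1`, Honest scope (2)) by
the `ℓ¹` carrier with the same symmetric operators: a functional `A ↦ ⟨∇A, J⟩` applied to the direct walk of `G e` IS the
adjoint walk of `G∇*J` read at a point; the paper does not name a norm for it.  (3) Fields real (print: real), sup norm
= max over components and sites exactly as (1.108); `a > 0` a parameter (print: a = 1).  CELL BOOK-KEEPING (lit-balaban):
rows B5.Prop1.2 (S1-torus programme, p38 half, file A), B5.Eq1.115-1.117 ((1.115) read on the walk carriers), B5.Eq1.118 /
B5.Eq1.123 (sup and adjoint carriers of the walk) — cells only, NO head change; value = plumbing for the printed route, NOT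
summit progress.  v1.1 (p38 gen 9, DOCFIX ONLY — second-reader note r05 22-(b) = referee note ref-4 S-B5-g39-1): the page
numeral of «The factors with G are estimated by using (1.115).» corrected p. 37 → p. 38 [PDF 22 L5–6] in this header and in
four cite tags of §3; declarations byte-identical.
-/
import Mathlib
import Literature.MathematicalPhysics.QuantumFieldTheory.Balaban1983to89.B5SupCommutator128
import Literature.MathematicalPhysics.QuantumFieldTheory.Balaban1983to89.B5WalkCarrierTorus

open Finset

namespace Literature.MathematicalPhysics.QuantumFieldTheory.Balaban1983to89.B5SupCarrierTorus

open scoped BigOperators Matrix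
open WithLp
open Literature.MathematicalPhysics.QuantumFieldTheory.Balaban1983to89
open Literature.MathematicalPhysics.QuantumFieldTheory.Balaban1983to89.B5Prop11Plancherel (Tor fine)
open Literature.MathematicalPhysics.QuantumFieldTheory.Balaban1983to89.B5Prop11Lattice (grad divT)
open Literature.MathematicalPhysics.QuantumFieldTheory.Balaban1983to89.B5Prop12FieldsLattice (cubeT cubeB supNormL eL
  eL_zero_vec eL_one_vec eL_two_ten)
open Literature.MathematicalPhysics.QuantumFieldTheory.Balaban1983to89.B5RealFields (GR DeltaAR fdiffR gradR divTR cplx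
  cplx_GR_mulVec cplx_gradR cplx_divTR)
open Literature.MathematicalPhysics.QuantumFieldTheory.Balaban1983to89.B5SettingP12Real (LocR VecR latticeSettingP12R gP12R)
open Literature.MathematicalPhysics.QuantumFieldTheory.Balaban1983to89.B5WalkTorusGeom (TorR ucPt Cen)
open Literature.MathematicalPhysics.QuantumFieldTheory.Balaban1983to89.B5WalkPartitionTorus (hz hz_nonneg hz_le_one
  abs_hz_le_one sum_hz_sq)
open Literature.MathematicalPhysics.QuantumFieldTheory.Balaban1983to89.B5WalkCarrierTorus (Bnd)
open Literature.MathematicalPhysics.QuantumFieldTheory.Balaban1983to89.B5SupCommutator128 (mulOpS kerOpS mulOpS_apply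
  kerOpS_apply mulOpS_mul kerOpS_mul_kerOpS kerOpS_delta kerOpS_add norm_mulOpS_le abs_apply_le_norm)
open Literature.MathematicalPhysics.QuantumFieldTheory.Balaban1983to89.B5CoverP12Lattice (nearOf mem_cubeB_nearOf)
open Literature.MathematicalPhysics.QuantumFieldTheory.Balaban1983to89.LatticeNorms (supNorm supNorm_le norm_le_supNorm
  supNorm_nonneg)

noncomputable section

variable {d : ℕ}

/-! ## §1 The sup carrier `VecR n M` (the norm `|A|` of (1.108)) and the operators of the walk on it -/

section Sup

variable (n : ℕ) [NeZero n] (M : Fin d → ℕ) [hM : ∀ μ, NeZero (M μ)] (a : ℝ) (M₀ : ℕ)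

/-- the coefficient function of the multiplier `h_z` on the bonds `(x, μ)` (constant in `μ`): p38-gen-7՚s profile `hz` at the
unit-scale position of `x`. [cite: Balaban1984PropagatorsI, (1.118) p.36] -/
def hcoefS (z : Cen M M₀) : Bnd n M → ℝ := fun b => hz M M₀ z (ucPt M n b.1)

/-- **the multiplier `h_z` on the sup carrier** (`B5SupCommutator128.mulOpS`). [cite: Balaban1984PropagatorsI, (1.118)–(1.119) p.36] -/
def Hs (z : Cen M M₀) : Module.End ℝ (VecR n M) := mulOpS (hcoefS n M M₀ z)

/-- **`G = Δ_a⁻¹` on the sup carrier**: the kernel operator of pv15՚s real matrix `GR = re (DeltaA n M a)⁻¹`.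
[cite: Balaban1984PropagatorsI, (1.71) p.30 («Δ_a⁻¹ = G_k, or simply G»)] -/
def Gs : Module.End ℝ (VecR n M) := kerOpS fun i j => GR n M a i j

/-- **`Δ_a` on the sup carrier**: the kernel operator of `DeltaAR = re (DeltaA n M a)` (r02՚s `Δ − ∂P∂* + aQ*Q`).
[cite: Balaban1984PropagatorsI, (1.69) p.29, (1.73) p.30] -/
def DAs : Module.End ℝ (VecR n M) := kerOpS fun i j => DeltaAR n M a i j

/-- **the gradient `∇` as the size map `|∇A|` of (1.128)** on the sup carrier: `(∇A)_ν = ∇_νA` (`B5RealFields.gradR`, lattice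
factor `η⁻¹`), valued in `Fin d → VecR n M` with the sup norm `max_{μ,ν} sup_x` of (1.108).
[cite: Balaban1984PropagatorsI, (1.108) p.35, (1.128) p.38] -/
def Dgs : VecR n M →ₗ[ℝ] (Fin d → VecR n M) where
  toFun B := gradR n M B
  map_add' B B' := by
    funext ν
    simp only [gradR, Matrix.mulVec_add, Pi.add_apply]
  map_smul' c B := by
    funext ν
    simp only [gradR, Matrix.mulVec_smul, Pi.smul_apply, RingHom.id_apply]

variable {n M a M₀}

omit [NeZero n] hM in
/-- pointwise action of `h_z`. [cite: Balaban1984PropagatorsI, (1.118) p.36] -/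
@[simp] theorem Hs_apply (z : Cen M M₀) (B : VecR n M) (b : Bnd n M) :
    Hs n M M₀ z B b = hz M M₀ z (ucPt M n b.1) * B b := rfl

omit [NeZero n] hM in
/-- `Hs z` is r02՚s multiplier `mulOpS (hcoefS z)` (for the (1.128) schema). [cite: Balaban1984PropagatorsI, (1.118) p.36] -/
theorem Hs_eq (z : Cen M M₀) : Hs n M M₀ z = mulOpS (hcoefS n M M₀ z) := rfl

omit [NeZero n] hM in
/-- `|h_z| ≤ 1` on bonds. [cite: Balaban1984PropagatorsI, (1.118) p.36] -/
theorem abs_hcoefS_le_one (z : Cen M M₀) (b : Bnd n M) : |hcoefS n M M₀ z b| ≤ 1 := abs_hz_le_one M M₀ z _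

omit [NeZero n] hM in
/-- `0 ≤ h_z` on bonds. [cite: Balaban1984PropagatorsI, (1.118) p.36] -/
theorem hcoefS_nonneg (z : Cen M M₀) (b : Bnd n M) : 0 ≤ hcoefS n M M₀ z b := hz_nonneg M M₀ z _

omit [NeZero n] hM in
/-- `h_z ≤ 1` on bonds. [cite: Balaban1984PropagatorsI, (1.118) p.36] -/
theorem hcoefS_le_one (z : Cen M M₀) (b : Bnd n M) : hcoefS n M M₀ z b ≤ 1 := hz_le_one M M₀ z _

/-- pointwise action of `G`: the matrix `GR`. [cite: Balaban1984PropagatorsI, (1.71) p.30] -/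
theorem Gs_apply (B : VecR n M) : Gs n M a B = GR n M a *ᵥ B := by
  funext i
  simp only [Gs, kerOpS_apply, Matrix.mulVec, dotProduct]

/-- pointwise action of `Δ_a`: the matrix `DeltaAR`. [cite: Balaban1984PropagatorsI, (1.73) p.30] -/
theorem DAs_apply (B : VecR n M) : DAs n M a B = DeltaAR n M a *ᵥ B := by
  funext i
  simp only [DAs, kerOpS_apply, Matrix.mulVec, dotProduct]

/-- pointwise action of `∇`. [cite: Balaban1984PropagatorsI, (1.108) p.35 (|∇A|)] -/
@[simp] theorem Dgs_apply (B : VecR n M) (ν : Fin d) : Dgs n M B ν = fdiffR n M ν *ᵥ B := rfl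

/-- `Δ_a = l + k` entrywise gives `DAs = kerOpS l + kerOpS k` — the split consumed by r02՚s schema `h128_schemaS`
(finite-range part + (1.126) kernel part). [cite: Balaban1984PropagatorsI, (1.69) p.29, (1.128) p.38] -/
theorem DAs_eq_kerOpS_add {l k : Bnd n M → Bnd n M → ℝ} (h : ∀ i j, DeltaAR n M a i j = l i j + k i j) :
    DAs n M a = kerOpS l + kerOpS k := by
  rw [← kerOpS_add]
  unfold DAs
  congr 1
  funext i j
  exact h i j

/-- **(1.71) `Δ_a G = 1`** on the sup carrier. [cite: Balaban1984PropagatorsI, (1.71) p.30] -/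
theorem DAs_mul_Gs (hn : 1 ≤ n) (ha : 0 < a) : DAs n M a * Gs n M a = 1 := by
  classical
  rw [DAs, Gs, kerOpS_mul_kerOpS]
  have h := B5RealFields.DeltaAR_mul_GR n hn M a ha
  have hk : (fun i j : Bnd n M => ∑ m, DeltaAR n M a i m * GR n M a m j)
      = fun i j : Bnd n M => if i = j then (1 : ℝ) else 0 := by
    funext i j
    have hij := congrFun (congrFun h i) j
    rw [Matrix.mul_apply] at hij
    rw [hij, Matrix.one_apply]
  rw [hk]
  convert kerOpS_delta (ι := Bnd n M) using 3

/-- **(1.71) `G Δ_a = 1`** on the sup carrier. [cite: Balaban1984PropagatorsI, (1.71) p.30] -/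
theorem Gs_mul_DAs (hn : 1 ≤ n) (ha : 0 < a) : Gs n M a * DAs n M a = 1 := by
  classical
  rw [DAs, Gs, kerOpS_mul_kerOpS]
  have h := B5RealFields.GR_mul_DeltaAR n hn M a ha
  have hk : (fun i j : Bnd n M => ∑ m, GR n M a i m * DeltaAR n M a m j)
      = fun i j : Bnd n M => if i = j then (1 : ℝ) else 0 := by
    funext i j
    have hij := congrFun (congrFun h i) j
    rw [Matrix.mul_apply] at hij
    rw [hij, Matrix.one_apply]
  rw [hk]
  convert kerOpS_delta (ι := Bnd n M) using 3

omit [NeZero n] hM in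
/-- **(1.118) `Σ_z h_z h_z = 1`** on the sup carrier — the field `h118`. [cite: Balaban1984PropagatorsI, (1.118) p.36 («hence Σ_z h_z²(x) = 1»)] -/
theorem h118S : ∑ z : Cen M M₀, Hs n M M₀ z * Hs n M M₀ z = 1 := by
  apply LinearMap.ext
  intro v
  funext b
  simp only [Hs, mulOpS_mul, LinearMap.coe_sum, Finset.sum_apply, mulOpS_apply, Module.End.one_apply]
  rw [← Finset.sum_mul]
  have h := sum_hz_sq M M₀ (ucPt M n b.1)
  have h' : ∑ z : Cen M M₀, hcoefS n M M₀ z b * hcoefS n M M₀ z b = 1 := by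
    rw [← h]
    exact Finset.sum_congr rfl fun z _ => by rw [hcoefS, sq]
  rw [h', one_mul]

/-- **`|h_zA| ≤ |A|`** on the sup carrier — the field `normH`. [cite: Balaban1984PropagatorsI, (1.118) p.36, (1.108) p.35] -/
theorem norm_Hs_le (z : Cen M M₀) (v : VecR n M) : ‖Hs n M M₀ z v‖ ≤ ‖v‖ := by
  have h := norm_mulOpS_le (a := hcoefS n M M₀ z) zero_le_one (abs_hcoefS_le_one z) v
  rw [one_mul] at h
  exact h

end Sup

/-! ## §2 The adjoint carrier `ℓ¹` (p. 39 «a representation of G adjoint to (1.123)») -/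

section Adjoint

variable (n : ℕ) [NeZero n] (M : Fin d → ℕ) [hM : ∀ μ, NeZero (M μ)] (a : ℝ) (M₀ : ℕ)

/-- **the adjoint carrier**: real vector fields with the `ℓ¹` norm `Σ_{x,μ} |A_μ(x)|` (the dual of the sup norm (1.108)), on
which the transposed (= the same, symmetric) operators realise p. 39՚s «representation of G adjoint to (1.123), with the
operators K(h) acting on the right». [cite: Balaban1984PropagatorsI, p.39 L7–9, (1.108) p.35] -/
abbrev V1 : Type := PiLp 1 (fun _ : Bnd n M => ℝ)

/-- the `ℓ¹` target of the gradient on the adjoint carrier (index `(ν, (x, μ))`). [cite: Balaban1984PropagatorsI, p.39 L7–9, (1.108) p.35] -/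
abbrev Vg1 : Type := PiLp 1 (fun _ : Fin d × Bnd n M => ℝ)

/-- the identification of the adjoint carrier with the functions (Mathlib՚s `WithLp.linearEquiv`). [cite: Balaban1984PropagatorsI, p.39 L7–9] -/
def eS : V1 n M ≃ₗ[ℝ] VecR n M := WithLp.linearEquiv 1 ℝ (Bnd n M → ℝ)

/-- `h_z` on the adjoint carrier. [cite: Balaban1984PropagatorsI, (1.118) p.36, p.39 L7–9] -/
def H1 (z : Cen M M₀) : Module.End ℝ (V1 n M) := (eS n M).symm.conj (Hs n M M₀ z)

/-- `G` on the adjoint carrier. [cite: Balaban1984PropagatorsI, (1.71) p.30, p.39 L7–9] -/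
def G1 : Module.End ℝ (V1 n M) := (eS n M).symm.conj (Gs n M a)

/-- `Δ_a` on the adjoint carrier. [cite: Balaban1984PropagatorsI, (1.73) p.30, p.39 L7–9] -/
def DA1 : Module.End ℝ (V1 n M) := (eS n M).symm.conj (DAs n M a)

/-- `∇` on the adjoint carrier, valued in `ℓ¹` over `(ν, (x, μ))`. [cite: Balaban1984PropagatorsI, (1.108) p.35, p.39 L7–9] -/
def Dg1 : V1 n M →ₗ[ℝ] Vg1 n M where
  toFun v := toLp 1 fun q : Fin d × Bnd n M => (fdiffR n M q.1 *ᵥ ofLp v) q.2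
  map_add' v w := by
    apply PiLp.ext
    intro q
    simp only [ofLp_add, Matrix.mulVec_add, Pi.add_apply]
  map_smul' c v := by
    apply PiLp.ext
    intro q
    simp only [ofLp_smul, Matrix.mulVec_smul, Pi.smul_apply, RingHom.id_apply]

variable {n M a M₀}

/-- the `ℓ¹` norm of the adjoint carrier. [cite: Balaban1984PropagatorsI, p.39 L7–9, (1.108) p.35] -/
theorem norm_V1 (v : V1 n M) : ‖v‖ = ∑ b, |v b| := by
  rw [PiLp.norm_eq_of_L1]
  rfl

/-- the `ℓ¹` norm of the gradient target. [cite: Balaban1984PropagatorsI, p.39 L7–9, (1.108) p.35] -/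
theorem norm_Vg1 (v : Vg1 n M) : ‖v‖ = ∑ q, |v q| := by
  rw [PiLp.norm_eq_of_L1]
  rfl

omit [NeZero n] hM in
/-- conjugated operators act through `ofLp`/`toLp`. [cite: Balaban1984PropagatorsI, p.39 L7–9] -/
theorem conj_apply (T : Module.End ℝ (VecR n M)) (v : V1 n M) :
    (eS n M).symm.conj T v = toLp 1 (T (ofLp v)) := by
  rw [LinearEquiv.conj_apply]
  rfl

omit [NeZero n] hM in
/-- `ofLp` of a conjugated operator. [cite: Balaban1984PropagatorsI, p.39 L7–9] -/
theorem ofLp_conj_apply (T : Module.End ℝ (VecR n M)) (v : V1 n M) :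
    ofLp ((eS n M).symm.conj T v) = T (ofLp v) := by
  rw [conj_apply]

omit [NeZero n] hM in
/-- pointwise action of `h_z` on the adjoint carrier. [cite: Balaban1984PropagatorsI, (1.118) p.36, p.39 L7–9] -/
@[simp] theorem H1_apply (z : Cen M M₀) (v : V1 n M) (b : Bnd n M) :
    H1 n M M₀ z v b = hz M M₀ z (ucPt M n b.1) * v b := by
  show ofLp ((eS n M).symm.conj (Hs n M M₀ z) v) b = _
  rw [ofLp_conj_apply]
  rfl

/-- pointwise action of `G` on the adjoint carrier. [cite: Balaban1984PropagatorsI, (1.71) p.30, p.39 L7–9] -/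
theorem ofLp_G1 (v : V1 n M) : ofLp (G1 n M a v) = GR n M a *ᵥ ofLp v := by
  rw [G1, ofLp_conj_apply, Gs_apply]

/-- pointwise action of `Δ_a` on the adjoint carrier. [cite: Balaban1984PropagatorsI, (1.73) p.30, p.39 L7–9] -/
theorem ofLp_DA1 (v : V1 n M) : ofLp (DA1 n M a v) = DeltaAR n M a *ᵥ ofLp v := by
  rw [DA1, ofLp_conj_apply, DAs_apply]

/-- pointwise action of `∇` on the adjoint carrier. [cite: Balaban1984PropagatorsI, (1.108) p.35, p.39 L7–9] -/
@[simp] theorem Dg1_apply (v : V1 n M) (q : Fin d × Bnd n M) : Dg1 n M v q = (fdiffR n M q.1 *ᵥ ofLp v) q.2 := rfl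

omit [NeZero n] hM in
/-- conjugation is multiplicative (folklore, `LinearEquiv.conj_comp`). [cite: Balaban1984PropagatorsI, p.39 L7–9] -/
theorem conj_mul (S T : Module.End ℝ (VecR n M)) :
    (eS n M).symm.conj (S * T) = (eS n M).symm.conj S * (eS n M).symm.conj T :=
  LinearEquiv.conj_comp _ _ _

omit [NeZero n] hM in
/-- conjugation preserves the identity (folklore, `LinearEquiv.conj_id`). [cite: Balaban1984PropagatorsI, p.39 L7–9] -/
theorem conj_one : (eS n M).symm.conj (1 : Module.End ℝ (VecR n M)) = 1 :=
  LinearEquiv.conj_id _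

/-- **(1.71) `Δ_a G = 1`** on the adjoint carrier. [cite: Balaban1984PropagatorsI, (1.71) p.30, p.39 L7–9] -/
theorem DA1_mul_G1 (hn : 1 ≤ n) (ha : 0 < a) : DA1 n M a * G1 n M a = 1 := by
  rw [DA1, G1, ← conj_mul, DAs_mul_Gs hn ha, conj_one]

/-- **(1.71) `G Δ_a = 1`** on the adjoint carrier. [cite: Balaban1984PropagatorsI, (1.71) p.30, p.39 L7–9] -/
theorem G1_mul_DA1 (hn : 1 ≤ n) (ha : 0 < a) : G1 n M a * DA1 n M a = 1 := by
  rw [DA1, G1, ← conj_mul, Gs_mul_DAs hn ha, conj_one]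

omit [NeZero n] hM in
/-- **(1.118) `Σ_z h_z h_z = 1`** on the adjoint carrier. [cite: Balaban1984PropagatorsI, (1.118) p.36, p.39 L7–9] -/
theorem h118one : ∑ z : Cen M M₀, H1 n M M₀ z * H1 n M M₀ z = 1 := by
  have h : ∑ z : Cen M M₀, H1 n M M₀ z * H1 n M M₀ z
      = (eS n M).symm.conj (∑ z : Cen M M₀, Hs n M M₀ z * Hs n M M₀ z) := by
    rw [map_sum]
    exact Finset.sum_congr rfl fun z _ => by rw [H1, conj_mul]
  rw [h, h118S, conj_one]

/-- **`‖h_zA‖₁ ≤ ‖A‖₁`** on the adjoint carrier. [cite: Balaban1984PropagatorsI, (1.118) p.36, p.39 L7–9] -/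
theorem norm_H1_le (z : Cen M M₀) (v : V1 n M) : ‖H1 n M M₀ z v‖ ≤ ‖v‖ := by
  rw [norm_V1, norm_V1]
  refine Finset.sum_le_sum fun b _ => ?_
  rw [H1_apply, abs_mul]
  have h1 : |hz M M₀ z (ucPt M n b.1)| ≤ 1 := abs_hz_le_one M M₀ z _
  have h0 : 0 ≤ |v b| := abs_nonneg _
  nlinarith

end Adjoint

/-! ## §3 The field (1.115) read on both carriers -/

section Reading

variable {n : ℕ} [NeZero n] {M : Fin d → ℕ} [hM : ∀ μ, NeZero (M μ)] {a : ℝ}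

omit [NeZero n] hM in
/-- the embedded real vector field is `cplx`. [cite: Balaban1984PropagatorsI, Prop. 1.2 (1.110) p.35 (real J)] -/
theorem emb_vec (B : VecR n M) : (LocR.vec B).emb = B5Prop11SettingModel.Loc189.vec (cplx B) := rfl

omit [NeZero n] hM in
/-- the embedded real tensor field is `cplx` componentwise. [cite: Balaban1984PropagatorsI, Prop. 1.2 (1.110) p.35 (real J)] -/
theorem emb_ten (T : Fin d → VecR n M) :
    (LocR.ten T).emb = B5Prop11SettingModel.Loc189.ten fun ν => cplx (T ν) := rfl

/-- **the typed `|J|` (1.108) of a real vector field is its sup norm.** [cite: Balaban1984PropagatorsI, (1.108) p.35] -/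
theorem supNorm_cplx_eq (B : VecR n M) : supNorm Finset.univ (cplx B) = ‖B‖ := by
  apply le_antisymm
  · exact supNorm_le (norm_nonneg _) fun b _ => by
      rw [show cplx B b = ((B b : ℝ) : ℂ) from rfl, Complex.norm_real]
      exact norm_le_pi_norm B b
  · exact (pi_norm_le_iff_of_nonneg (supNorm_nonneg _ _)).mpr fun b => by
      rw [← Complex.norm_real]
      exact norm_le_supNorm (cplx B) (Finset.mem_univ b)

/-- **the typed `|J|` (1.108) of a real tensor field is its sup norm.** [cite: Balaban1984PropagatorsI, (1.108) p.35] -/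
theorem supNorm_ten_cplx_eq (T : Fin d → VecR n M) :
    supNorm Finset.univ (fun p : Fin d × Bnd n M => cplx (T p.1) p.2) = ‖T‖ := by
  apply le_antisymm
  · exact supNorm_le (norm_nonneg _) fun p _ => by
      rw [show cplx (T p.1) p.2 = ((T p.1 p.2 : ℝ) : ℂ) from rfl, Complex.norm_real]
      exact (norm_le_pi_norm (T p.1) p.2).trans (norm_le_pi_norm T p.1)
  · refine (pi_norm_le_iff_of_nonneg (supNorm_nonneg _ _)).mpr fun ν => ?_
    refine (pi_norm_le_iff_of_nonneg (supNorm_nonneg _ _)).mpr fun b => ?_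
    rw [← Complex.norm_real]
    exact norm_le_supNorm (fun p : Fin d × Bnd n M => cplx (T p.1) p.2) (Finset.mem_univ (ν, b))

/-- the setting՚s `|vec B|` is `‖B‖`. [cite: Balaban1984PropagatorsI, (1.108) p.35] -/
theorem setting_supNorm_vec (k : ℕ) (B : VecR n M) : (latticeSettingP12R n M a k).supNorm (LocR.vec B) = ‖B‖ :=
  supNorm_cplx_eq B

/-- the setting՚s `|ten T|` is `‖T‖`. [cite: Balaban1984PropagatorsI, (1.108) p.35] -/
theorem setting_supNorm_ten (k : ℕ) (T : Fin d → VecR n M) :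
    (latticeSettingP12R n M a k).supNorm (LocR.ten T) = ‖T‖ :=
  supNorm_ten_cplx_eq T

/-- **cubewise sup bounds give the global sup bound** (every bond lies in some `Δ̃(y)`: `B5CoverP12Lattice.mem_cubeB_nearOf`) —
the reading «|GJ| = sup_y sup_{x∈Δ̃(y)}» behind (1.115). [cite: Balaban1984PropagatorsI, (1.115) p.36, p.35 (the cubes Δ̃(y))] -/
theorem norm_le_of_cubewise (hn : 1 ≤ n) {F : VecR n M} {c : ℝ} (hc : 0 ≤ c)
    (h : ∀ y : Tor M, supNorm (cubeB n M y) (cplx F) ≤ c) : ‖F‖ ≤ c := by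
  refine (pi_norm_le_iff_of_nonneg hc).mpr fun b => ?_
  have h1 := norm_le_supNorm (cplx F) (mem_cubeB_nearOf M n hn b)
  rw [show cplx F b = ((F b : ℝ) : ℂ) from rfl, Complex.norm_real] at h1
  exact h1.trans (h _)

/-- cubewise sup bounds for a tensor field give the global sup bound. [cite: Balaban1984PropagatorsI, (1.115) p.36, p.35 (the cubes Δ̃(y))] -/
theorem norm_ten_le_of_cubewise (hn : 1 ≤ n) {F : Fin d → VecR n M} {c : ℝ} (hc : 0 ≤ c)
    (h : ∀ y : Tor M, supNorm (Finset.univ ×ˢ cubeB n M y) (fun p : Fin d × Bnd n M => cplx (F p.1) p.2) ≤ c) :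
    ‖F‖ ≤ c := by
  refine (pi_norm_le_iff_of_nonneg hc).mpr fun ν => (pi_norm_le_iff_of_nonneg hc).mpr fun b => ?_
  have hmem : (ν, b) ∈ Finset.univ ×ˢ cubeB n M (nearOf M n b.1) :=
    Finset.mem_product.mpr ⟨Finset.mem_univ ν, mem_cubeB_nearOf M n hn b⟩
  have h1 := norm_le_supNorm (fun p : Fin d × Bnd n M => cplx (F p.1) p.2) hmem
  rw [show cplx (F ν) b = ((F ν b : ℝ) : ℂ) from rfl, Complex.norm_real] at h1
  exact h1.trans (h _)

variable (k : ℕ) {C : ℝ} {Cα Cε : ℝ → ℝ} {Cαε : ℝ → ℝ → ℝ}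

/-- **(1.115), member `|GJ| ≤ O(1)|J|`, READ ON THE SUP CARRIER: `‖G B‖ ≤ C‖B‖`.** («The factors with G are estimated by
using (1.115)», p. 38.) [cite: Balaban1984PropagatorsI, (1.115) p.36, p.38] -/
theorem norm_Gs_le_of_global (hn : 1 ≤ n) (hC : 0 ≤ C)
    (hG : B5.Global115_117 (latticeSettingP12R n M a k) (gP12R M n a k) C Cα Cε Cαε) (B : VecR n M) :
    ‖Gs n M a B‖ ≤ C * ‖B‖ := by
  rw [Gs_apply]
  refine norm_le_of_cubewise hn (mul_nonneg hC (norm_nonneg B)) fun y => ?_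
  have h1 := hG.1 0 (LocR.vec B) y
  have h2 : (latticeSettingP12R n M a k).e 0 (LocR.vec B) y
      = supNorm (cubeB n M y) ((B5DeltaA169.DeltaA n M a)⁻¹ *ᵥ cplx B) := rfl
  rw [h2, setting_supNorm_vec, ← cplx_GR_mulVec] at h1
  exact h1

/-- **(1.115), member `|∇GJ| ≤ O(1)|J|`, READ ON THE SUP CARRIER: `‖∇(G B)‖ ≤ C‖B‖`.**
[cite: Balaban1984PropagatorsI, (1.115) p.36, p.38] -/
theorem norm_Dgs_Gs_le_of_global (hn : 1 ≤ n) (hC : 0 ≤ C)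
    (hG : B5.Global115_117 (latticeSettingP12R n M a k) (gP12R M n a k) C Cα Cε Cαε) (B : VecR n M) :
    ‖Dgs n M (Gs n M a B)‖ ≤ C * ‖B‖ := by
  rw [Gs_apply]
  refine norm_ten_le_of_cubewise hn (mul_nonneg hC (norm_nonneg B)) fun y => ?_
  have h1 := hG.1 1 (LocR.vec B) y
  have h2 : (latticeSettingP12R n M a k).e 1 (LocR.vec B) y
      = supNorm (Finset.univ ×ˢ cubeB n M y) (fun p : Fin d × Bnd n M =>
          grad n M ((B5DeltaA169.DeltaA n M a)⁻¹ *ᵥ cplx B) p.1 p.2) := rfl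
  rw [h2, setting_supNorm_vec, ← cplx_GR_mulVec] at h1
  refine le_trans (le_of_eq ?_) h1
  congr 1
  funext p
  rw [Dgs_apply, ← gradR, cplx_gradR]

/-- **(1.115), member `|G∇*J| ≤ O(1)|J|`, READ ON THE SUP CARRIER: `‖G ∇*T‖ ≤ C‖T‖`.**
[cite: Balaban1984PropagatorsI, (1.115) p.36, p.38] -/
theorem norm_Gs_divTR_le_of_global (hn : 1 ≤ n) (hC : 0 ≤ C)
    (hG : B5.Global115_117 (latticeSettingP12R n M a k) (gP12R M n a k) C Cα Cε Cαε) (T : Fin d → VecR n M) :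
    ‖Gs n M a (divTR n M T)‖ ≤ C * ‖T‖ := by
  rw [Gs_apply]
  refine norm_le_of_cubewise hn (mul_nonneg hC (norm_nonneg T)) fun y => ?_
  have h1 := hG.1 2 (LocR.ten T) y
  have h2 : (latticeSettingP12R n M a k).e 2 (LocR.ten T) y
      = supNorm (cubeB n M y) ((B5DeltaA169.DeltaA n M a)⁻¹ *ᵥ divT n M fun ν => cplx (T ν)) := rfl
  rw [h2, setting_supNorm_ten, ← cplx_divTR, ← cplx_GR_mulVec] at h1
  exact h1

/-! ### the adjoint carrier: (1.115) by duality -/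

/-- the coordinates of a `±1/0`-valued sign vector are bounded by `1` in sup norm (folklore).
[cite: Balaban1984PropagatorsI, (1.108) p.35] -/
theorem norm_sign_le_one {κ : Type} [Fintype κ] (u : κ → ℝ) :
    ‖(fun q => ((SignType.sign (u q) : SignType) : ℝ))‖ ≤ 1 := by
  refine (pi_norm_le_iff_of_nonneg zero_le_one).mpr fun q => ?_
  rcases lt_trichotomy (u q) 0 with h | h | h
  · rw [sign_neg h]; simp
  · rw [h, sign_zero]; simp
  · rw [sign_pos h]; simp

/-- **`ℓ¹`/`ℓ^∞` DUALITY** (folklore): if the transpose of a real matrix `T` is bounded by `C` in sup norm, then `T` is bounded by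
`C` in `ℓ¹` norm: `Σ_q |(Tw)_q| ≤ C Σ_j |w_j|` — the mechanism by which the members `|GJ|`, `|G∇*J|` of (1.115) control the
adjoint representation of p. 39. [cite: Balaban1984PropagatorsI, p.39 L7–9, (1.115) p.36] -/
theorem sum_abs_mulVec_le_of_transpose {ι κ : Type} [Fintype ι] [Fintype κ] (T : Matrix κ ι ℝ) {C : ℝ} (hC : 0 ≤ C)
    (hT : ∀ v : κ → ℝ, ‖Tᵀ *ᵥ v‖ ≤ C * ‖v‖) (w : ι → ℝ) :
    ∑ q, |(T *ᵥ w) q| ≤ C * ∑ j, |w j| := by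
  set s : κ → ℝ := fun q => ((SignType.sign ((T *ᵥ w) q) : SignType) : ℝ) with hs
  have hs1 : ‖s‖ ≤ 1 := norm_sign_le_one (T *ᵥ w)
  have h1 : ∑ q, |(T *ᵥ w) q| = ∑ q, s q * (T *ᵥ w) q :=
    Finset.sum_congr rfl fun q _ => (sign_mul_self ((T *ᵥ w) q)).symm
  have h2 : ∑ q, s q * (T *ᵥ w) q = ∑ j, (Tᵀ *ᵥ s) j * w j := by
    have e1 : s ⬝ᵥ (T *ᵥ w) = (Tᵀ *ᵥ s) ⬝ᵥ w := by
      rw [Matrix.dotProduct_mulVec, Matrix.mulVec_transpose]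
    simpa only [dotProduct] using e1
  have hT' : ∀ j, |(Tᵀ *ᵥ s) j| ≤ C := fun j => by
    have := abs_apply_le_norm (Tᵀ *ᵥ s) j
    have := hT s
    nlinarith [norm_nonneg s]
  rw [h1, h2, Finset.mul_sum]
  refine Finset.sum_le_sum fun j _ => ?_
  calc (Tᵀ *ᵥ s) j * w j ≤ |(Tᵀ *ᵥ s) j * w j| := le_abs_self _
    _ = |(Tᵀ *ᵥ s) j| * |w j| := abs_mul _ _
    _ ≤ C * |w j| := mul_le_mul_of_nonneg_right (hT' j) (abs_nonneg _)

/-- **(1.115) READ ON THE ADJOINT CARRIER, member `G`: `‖G w‖₁ ≤ C‖w‖₁`**, by duality from `|GJ| ≤ O(1)|J|` and «G is a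
symmetric operator» (Prop. 1.1). [cite: Balaban1984PropagatorsI, (1.115) p.36, Prop. 1.1 p.33, p.39 L7–9] -/
theorem norm_G1_le_of_global (hn : 1 ≤ n) (ha : 0 < a) (hC : 0 ≤ C)
    (hG : B5.Global115_117 (latticeSettingP12R n M a k) (gP12R M n a k) C Cα Cε Cαε) (w : V1 n M) :
    ‖G1 n M a w‖ ≤ C * ‖w‖ := by
  rw [norm_V1, norm_V1]
  have hp : ∀ b, |G1 n M a w b| = |(GR n M a *ᵥ ofLp w) b| := fun b => by
    rw [show G1 n M a w b = ofLp (G1 n M a w) b from rfl, ofLp_G1]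
  simp_rw [hp]
  refine sum_abs_mulVec_le_of_transpose (GR n M a) hC (fun v => ?_) (ofLp w)
  rw [B5RealFields.GR_transpose n hn M a ha, ← Gs_apply]
  exact norm_Gs_le_of_global k hn hC hG v

/-- pointwise form of the real divergence `∇*T = Σ_ν ∇_νᵀ T_ν`. [cite: Balaban1984PropagatorsI, (1.89) p.33 (∇*)] -/
theorem divTR_apply (T : Fin d → VecR n M) (m : Bnd n M) :
    divTR n M T m = ∑ ν, ∑ b, fdiffR n M ν b m * T ν b := by
  unfold divTR
  rw [Finset.sum_apply m Finset.univ (fun ν => (fdiffR n M ν)ᵀ *ᵥ T ν)]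
  simp only [Matrix.mulVec, dotProduct, Matrix.transpose_apply]

/-- the matrix of `∇ ∘ G` with row index `(ν, (x, μ))`. [cite: Balaban1984PropagatorsI, (1.115) p.36 (|∇GJ|)] -/
def gradGMat (n : ℕ) [NeZero n] (M : Fin d → ℕ) [∀ μ, NeZero (M μ)] (a : ℝ) :
    Matrix (Fin d × Bnd n M) (Bnd n M) ℝ :=
  fun q j => (fdiffR n M q.1 * GR n M a) q.2 j

/-- `gradGMat` acts as `∇(G w)`. [cite: Balaban1984PropagatorsI, (1.115) p.36 (|∇GJ|)] -/
theorem gradGMat_mulVec (w : VecR n M) (q : Fin d × Bnd n M) :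
    (gradGMat n M a *ᵥ w) q = (fdiffR n M q.1 *ᵥ (GR n M a *ᵥ w)) q.2 := by
  rw [Matrix.mulVec_mulVec]
  rfl

/-- the transpose of `gradGMat` acts as `G∇*` on curried tensor fields (uses `Gᵀ = G`).
[cite: Balaban1984PropagatorsI, (1.115) p.36 (|G∇*J|), Prop. 1.1 p.33] -/
theorem gradGMat_transpose_mulVec (hn : 1 ≤ n) (ha : 0 < a) (s : Fin d × Bnd n M → ℝ) :
    (gradGMat n M a)ᵀ *ᵥ s = GR n M a *ᵥ divTR n M (fun ν b => s (ν, b)) := by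
  have hG : ∀ i m, GR n M a i m = GR n M a m i := fun i m => by
    have := congrFun (congrFun (B5RealFields.GR_transpose n hn M a ha) i) m
    rw [Matrix.transpose_apply] at this
    exact this.symm
  funext j
  simp only [Matrix.mulVec, dotProduct, Matrix.transpose_apply, gradGMat, Matrix.mul_apply, divTR_apply]
  have hR : ∀ m, (∑ ν, ∑ b, fdiffR n M ν b m * s (ν, b))
      = ∑ q : Fin d × Bnd n M, fdiffR n M q.1 q.2 m * s q :=
    fun m => (Fintype.sum_prod_type (fun q : Fin d × Bnd n M => fdiffR n M q.1 q.2 m * s q)).symm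
  simp_rw [hR, Finset.mul_sum, Finset.sum_mul]
  rw [Finset.sum_comm]
  refine Finset.sum_congr rfl fun m _ => Finset.sum_congr rfl fun q _ => ?_
  rw [hG j m]
  ring

/-- uncurrying does not increase the sup norm (folklore). [cite: Balaban1984PropagatorsI, (1.108) p.35] -/
theorem norm_curry_le (s : Fin d × Bnd n M → ℝ) : ‖(fun ν b => s (ν, b) : Fin d → VecR n M)‖ ≤ ‖s‖ := by
  refine (pi_norm_le_iff_of_nonneg (norm_nonneg _)).mpr fun ν =>
    (pi_norm_le_iff_of_nonneg (norm_nonneg _)).mpr fun b => ?_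
  exact norm_le_pi_norm s (ν, b)

/-- **(1.115) READ ON THE ADJOINT CARRIER, member `∇G`: `‖∇(G w)‖₁ ≤ C‖w‖₁`**, by duality from `|G∇*J| ≤ O(1)|J|` and the
symmetry of `G`. [cite: Balaban1984PropagatorsI, (1.115) p.36, Prop. 1.1 p.33, p.39 L7–9] -/
theorem norm_Dg1_G1_le_of_global (hn : 1 ≤ n) (ha : 0 < a) (hC : 0 ≤ C)
    (hG : B5.Global115_117 (latticeSettingP12R n M a k) (gP12R M n a k) C Cα Cε Cαε) (w : V1 n M) :
    ‖Dg1 n M (G1 n M a w)‖ ≤ C * ‖w‖ := by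
  rw [norm_Vg1, norm_V1]
  have hp : ∀ q, |Dg1 n M (G1 n M a w) q| = |(gradGMat n M a *ᵥ ofLp w) q| := fun q => by
    rw [show Dg1 n M (G1 n M a w) q = ofLp (Dg1 n M (G1 n M a w)) q from rfl]
    rw [show ofLp (Dg1 n M (G1 n M a w)) q = (fdiffR n M q.1 *ᵥ ofLp (G1 n M a w)) q.2 from rfl, ofLp_G1,
      gradGMat_mulVec]
  simp_rw [hp]
  refine sum_abs_mulVec_le_of_transpose (gradGMat n M a) hC (fun v => ?_) (ofLp w)
  rw [gradGMat_transpose_mulVec hn ha, ← Gs_apply]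
  exact (norm_Gs_divTR_le_of_global k hn hC hG _).trans (mul_le_mul_of_nonneg_left (norm_curry_le v) hC)

/-- **THE FIELD `h115` OF `B5SupWalkS1.Rep` FOR THE SUP CARRIER** (any relative constant `c_G ≥ 1`): the typed global
inequalities (1.115)–(1.117) of the instance give `‖G B‖ ≤ c_G·C·‖B‖` and `‖∇(G B)‖ ≤ c_G·C·‖B‖`.
[cite: Balaban1984PropagatorsI, (1.115) p.36, p.38 («The factors with G are estimated by using (1.115)»)] -/
theorem h115S_holds (hn : 1 ≤ n) {cG : ℝ} (hcG : 1 ≤ cG) (C : ℝ) (Cα Cε : ℝ → ℝ) (Cαε : ℝ → ℝ → ℝ) (hC : 0 < C)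
    (hG : B5.Global115_117 (latticeSettingP12R n M a k) (gP12R M n a k) C Cα Cε Cαε) :
    (∀ B : VecR n M, ‖Gs n M a B‖ ≤ cG * C * ‖B‖) ∧ (∀ B : VecR n M, ‖Dgs n M (Gs n M a B)‖ ≤ cG * C * ‖B‖) := by
  have hmono : ∀ B : VecR n M, C * ‖B‖ ≤ cG * C * ‖B‖ := fun B => by
    have : 0 ≤ C * ‖B‖ := mul_nonneg hC.le (norm_nonneg B)
    nlinarith
  exact ⟨fun B => (norm_Gs_le_of_global k hn hC.le hG B).trans (hmono B),
    fun B => (norm_Dgs_Gs_le_of_global k hn hC.le hG B).trans (hmono B)⟩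

/-- **THE FIELD `h115` OF `B5SupWalkS1.Rep` FOR THE ADJOINT CARRIER** (any `c_G ≥ 1`).
[cite: Balaban1984PropagatorsI, (1.115) p.36, p.39 L7–9] -/
theorem h115one_holds (hn : 1 ≤ n) (ha : 0 < a) {cG : ℝ} (hcG : 1 ≤ cG) (C : ℝ) (Cα Cε : ℝ → ℝ) (Cαε : ℝ → ℝ → ℝ)
    (hC : 0 < C) (hG : B5.Global115_117 (latticeSettingP12R n M a k) (gP12R M n a k) C Cα Cε Cαε) :
    (∀ w : V1 n M, ‖G1 n M a w‖ ≤ cG * C * ‖w‖) ∧ (∀ w : V1 n M, ‖Dg1 n M (G1 n M a w)‖ ≤ cG * C * ‖w‖) := by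
  have hmono : ∀ w : V1 n M, C * ‖w‖ ≤ cG * C * ‖w‖ := fun w => by
    have : 0 ≤ C * ‖w‖ := mul_nonneg hC.le (norm_nonneg w)
    nlinarith
  exact ⟨fun w => (norm_G1_le_of_global k hn ha hC.le hG w).trans (hmono w),
    fun w => (norm_Dg1_G1_le_of_global k hn ha hC.le hG w).trans (hmono w)⟩

end Reading

end

end Literature.MathematicalPhysics.QuantumFieldTheory.Balaban1983to89.B5SupCarrierTorus
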